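import Summits.Ventures.HSemireg.WedgeHankelRecurrencePeriod
import Literature.Algebra.Polynomial.OrderOfPolynomial

/-!
# Venture HSemireg — THE LEAST PERIOD IS `ord(m)`: the periods of a dual class `dualSeq m a` (`gcd(m, a) = 1`) are exactly the multiples of the order `polOrd m` of the polynomial `m`
# (Lidl–Niederreiter's `ord`); over a finite field with `q` elements and `m(0) ≠ 0` **the least period is `ord(m)`, `1 ≤ ord(m) ≤ q^d − 1`, and for `m` irreducible `q^d − 1` is a period**
# («an LFSR of length `L` with non-singular feedback over `F_q` has least period `ord(m) ≤ q^L − 1`, dividing `q^L − 1` when the connection polynomial is irreducible»)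

HONEST FRAMING. Part of the Lean index of the computation cell `pub-hsemireg` (seat p10 gen 30, Sunday typer «UNIFORM-IN-n»).
LINEAR ALGEBRA OF HANKEL (catalecticant) MATRICES and of polynomials over a field ONLY: no variety, no cohomology theory, no sheaf, no Ext group and no semiregularity map is constructed
here; nothing here says that HC / HC_CM / HC_AV holds.  No unproved named fact is used: the PROVED Literature module `Literature.Algebra.Polynomial.OrderOfPolynomial` (Lidl–Niederreiter,
*Finite Fields*, Ch. 3: `polOrd f = orderOf (AdjoinRoot.root f)`, `dvd_X_pow_sub_one_iff`, `polOrd_pos`, `polOrd_le`, `polOrd_dvd_card_pow_sub_one`) supplies the order of a polynomial,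
and this file is the DICTIONARY between it and N81's periods — nothing of it is restated.  Custodian versions as in `WedgeHankelSiegelIdeal` (1/3).

WHAT IS IN THE TREE.  N81 (`WedgeHankelRecurrencePeriod`): `periodic_dualSeq_iff_dvd_mul` (`T`-periodic ↔ `m ∣ (X^T − 1)·a`), `periodic_dualSeq_iff_dvd` (`gcd(m, a) = 1`: ↔ `m ∣ X^T − 1`).
Literature (`OrderOfPolynomial`): as above.
THIS FILE (namespace `Summit.Ventures.HSemireg.Wedge.HankelOuter` continued; PLAIN on N81 + that Literature module; 0 definitions):
* §642 **`periodic_dualSeq_iff_polOrd_dvd`** (`gcd(m, a) = 1`: `T`-periodic ↔ `ord(m) ∣ T`), `periodic_dualSeq_of_polOrd_dvd` ∕ `periodic_dualSeq_polOrd` (every multiple of `ord(m)` is a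
  period of every dual class mod `m` — no coprimality needed), **`isLeast_setOf_periodic_dualSeq`** (finite field, `m(0) ≠ 0`, `gcd(m, a) = 1`: THE LEAST PERIOD IS `ord(m)`),
  **`exists_periodic_dualSeq_le`** (finite field, `deg m ≥ 1`, `m(0) ≠ 0`: a period `1 ≤ T ≤ q^d − 1`, any residue `a`), `periodic_dualSeq_card_pow_sub_one` (`m` irreducible, `m(0) ≠ 0`:
  `q^d − 1` is a period).
Nothing Ext-side.  New names only.
-/

open Module Polynomial
open scoped Matrix Polynomial

namespace Summit.Ventures.HSemireg.Wedge.HankelOuter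

open Summit.Ventures.HSemireg.Wedge Summit.Ventures.HSemireg.Wedge.Hankel
open Literature.Algebra.Polynomial.OrderOfPolynomial

variable (K : Type*) [Field K]

/-! ## §642. The least period is the order of `m` -/

/-- **the periods of `dualSeq m a` (`m` monic, `gcd(m, a) = 1`) are exactly the multiples of `ord(m) = polOrd m`** (any field; `polOrd m = 0` when `x mod m` has no finite order). -/
theorem periodic_dualSeq_iff_polOrd_dvd {m a : K[X]} (hm : m.Monic) (hcop : IsCoprime m a) (T : ℕ) : Function.Periodic (dualSeq K m a) T ↔ polOrd m ∣ T := by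
  rw [periodic_dualSeq_iff_dvd K hm hcop, dvd_X_pow_sub_one_iff]

/-- every multiple of `ord(m)` is a period of every dual class mod `m` (no coprimality of the residue `a` needed: `m ∣ X^T − 1 ∣ (X^T − 1)·a`). -/
theorem periodic_dualSeq_of_polOrd_dvd {m : K[X]} (hm : m.Monic) (a : K[X]) {T : ℕ} (h : polOrd m ∣ T) : Function.Periodic (dualSeq K m a) T :=
  (periodic_dualSeq_iff_dvd_mul K hm a T).mpr (dvd_mul_of_dvd_left ((dvd_X_pow_sub_one_iff m T).mpr h) a)

/-- in particular `ord(m)` itself is a period of every dual class mod `m`. -/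
theorem periodic_dualSeq_polOrd {m : K[X]} (hm : m.Monic) (a : K[X]) : Function.Periodic (dualSeq K m a) (polOrd m) :=
  periodic_dualSeq_of_polOrd_dvd K hm a dvd_rfl

/-- **THE LEAST PERIOD IS `ord(m)`**: over a finite field, for `m` monic with `m(0) ≠ 0` and a residue `a` prime to `m`, the least positive period of `dualSeq m a` is `polOrd m`
(«the least period of an LFSR sequence with non-singular feedback and reduced generating fraction `a/m` is `ord(m)`»). -/
theorem isLeast_setOf_periodic_dualSeq [Finite K] {m a : K[X]} (hm : m.Monic) (hcop : IsCoprime m a) (h0 : m.coeff 0 ≠ 0) :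
    IsLeast {T : ℕ | 0 < T ∧ Function.Periodic (dualSeq K m a) T} (polOrd m) :=
  ⟨⟨polOrd_pos h0, periodic_dualSeq_polOrd K hm a⟩, fun T hT => Nat.le_of_dvd hT.1 ((periodic_dualSeq_iff_polOrd_dvd K hm hcop T).mp hT.2)⟩

/-- **EVERY DUAL CLASS OVER A FINITE FIELD HAS A PERIOD `1 ≤ T ≤ q^d − 1`** (`m` monic of degree `d ≥ 1` with `m(0) ≠ 0`; any residue `a`): `T = ord(m)` (Lidl–Niederreiter Lemma 3.1). -/
theorem exists_periodic_dualSeq_le [Finite K] {m : K[X]} (hm : m.Monic) (hd : 1 ≤ m.natDegree) (h0 : m.coeff 0 ≠ 0) (a : K[X]) :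
    ∃ T : ℕ, 0 < T ∧ T ≤ Nat.card K ^ m.natDegree - 1 ∧ Function.Periodic (dualSeq K m a) T :=
  ⟨polOrd m, polOrd_pos h0, polOrd_le hd, periodic_dualSeq_polOrd K hm a⟩

/-- **`m` IRREDUCIBLE with `m(0) ≠ 0` ⇒ `q^d − 1` IS A PERIOD of every dual class mod `m`** (`ord(m) ∣ q^d − 1`, Lidl–Niederreiter Cor. 3.4). -/
theorem periodic_dualSeq_card_pow_sub_one [Finite K] {m : K[X]} (hm : m.Monic) (hirr : Irreducible m) (h0 : m.coeff 0 ≠ 0) (a : K[X]) :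
    Function.Periodic (dualSeq K m a) (Nat.card K ^ m.natDegree - 1) :=
  periodic_dualSeq_of_polOrd_dvd K hm a (polOrd_dvd_card_pow_sub_one hirr h0)

end Summit.Ventures.HSemireg.Wedge.HankelOuter
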